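import Summits.ResolutionOfSingularities.ResolutionOfSingularities.Theorems.PAlterationPialtSqueezeRRLU1
import Summits.ResolutionOfSingularities.ResolutionOfSingularities.Theorems.PAlterationPialtBridgeFoliationDescent
import Summits.ResolutionOfSingularities.ResolutionOfSingularities.Theorems.PAlterationPalterationThesisPerfectTransfer
import Summits.ResolutionOfSingularities.ResolutionOfSingularities.Theorems.PAlterationPialtKnownCases
import Summits.ResolutionOfSingularities.ResolutionOfSingularities.Theorems.ValuativePatchingReductions
import Literature.AlgebraicGeometry.Resolution.ProperModelsPatchingOfResolution
import Literature.AlgebraicGeometry.Resolution.ResolutionLU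
import Literature.AlgebraicGeometry.Resolution.AlterationsStrong
import HarnessLib

/-!
# `Pialt` (crux stmt-ResolutionOfSingularities-0555), line `SketchIdeator2`: the SPLIT GLUE over
# perfect fields — `Pialt ⇐ Temkin2013 ∧ RRLU1(perfect) ∧ Patching(perfect)`

Helper file of the line lead (c2), `--supports stmt-ResolutionOfSingularities-0555`; it does not
close any item. It makes the v4 skeleton's composition (`Cruxes/Pialt/Lines/SketchIdeator2.lean`)
available as CLOSED theorems whose hypotheses are exactly the candidate split children of the
crux, all restricted to PERFECT ground fields (the crux needs nothing more:
`pialt_of_pialt_perfectField`), so that a planner can split the crux `--glue-by` a landed theorem: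

* RRLU1 over perfect fields (`h1` below, INLINED — no new definition): for a perfect field `k` of
  characteristic `p`, fields `k ⊆ K ⊆ L` with `K/k` finitely generated, `L/K` purely inseparable
  generated by one `y` with `y ^ p ∈ K`, every finitely generated REGULAR `k`-subalgebra `B ⊆ L`
  with `Frac B = L` and every valuation ring `O ⊇ B` of `L`: `O ∩ K` is locally uniformizable
  over `k` — local uniformization below height-one Frobenius sandwiches of regular affine
  varieties (= of quotients of regular varieties by one `p`-closed rational vector field);
  verbatim the conclusion of the `FoliationDescent` bridge `rrLU1_perfect_of_folLU_of_logCanQuotLU`.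
* EITHER two-model patching of proper models over perfect fields (`hZ`, Piltant 2013 Prop. 5.1
  with `P = P_reg`, the perfect-field slice of `ProperModel.TwoModelPatching p` = the atom of crux
  `PatchingRel`, stmt-0642) — glue `pialt_of_temkin2013_rrLU1Perfect_twoModelPatchingPerfect`;
* OR absolute-LU patching over perfect fields (`hP`: local uniformization of every finitely
  generated extension of every perfect field of characteristic `p` implies weak resolution of
  every reduced separated scheme of finite type over every perfect field of characteristic `p` —
  the perfect-field slice of `Valuative.Patching`, stmt-0561; verbatim the registered stub
  `stub_patchingPerfect`) — glue `pialt_of_temkin2013_rrLU1Perfect_patchingPerfect`.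

Mechanism (all in tree): `Temkin2013` puts a regular affine model at the top of a finite purely
inseparable `L/K`; the field-by-field descent `isLocallyUniformizable_comap_of_rrLU1` (p136512)
brings local uniformization down to `K` using RRLU1 over the SAME ground field only; the
Zariski–Piltant engine `resolutionOverUpToDim_of_properPatching_of_lu` (absolute LU + two-model
patching of PROPER models, per field) or the patching hypothesis itself resolves every variety
over the perfect field; a resolution is a purely inseparable regular alteration
(`pialtOver_of_forall_hasResolution`); imperfect ground fields by `pialt_of_pialt_perfectField`.

Warrants (no child is stronger than the summit): `rrLU1Perfect_of_localUniformizationInChar`,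
`twoModelPatchingPerfect_of_twoModelPatching`, `patchingPerfect_of_twoModelPatchingPerfect`,
and `…_of_resolutionInChar` for all three children (`splitChildren_of_resolutionOfSingularities`).

Sources: M. Temkin, J. Algebra 373 (2013), Thm. 1.3.2, Rem. 1.3.5 (ii)–(iii); O. Piltant, RACSAM
107 (2013), Prop. 5.1, Cor. 5.7; O. Zariski, Ann. of Math. 41 (1940).
-/

set_option linter.dupNamespace false -- mandated namespace of this single-conjunct summit

noncomputable section

open CategoryTheory AlgebraicGeometry IsLocalRing
open Literature.AlgebraicGeometry.Resolution

namespace Summit.ResolutionOfSingularities.ResolutionOfSingularities.Theorems.Pialt.RadiciallyRegular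

open Summit.ResolutionOfSingularities.ResolutionOfSingularities.Theses.PAlteration (Pialt)
open Summit.ResolutionOfSingularities.ResolutionOfSingularities.Theses.FoliationDescent (FolLU LogCanQuotLU)

/-! ## Resolution over one perfect field from the three atoms at that field -/

/-- **Local uniformization of every finitely generated `K/k`, `k` PERFECT of characteristic `p`,
from `Temkin2013` and RRLU1 over perfect fields of characteristic `p`** (the descent
`isLocallyUniformizable_of_temkin2013_of_rrLU1_at` consumes RRLU1 over the given ground field
only). [cite: Temkin2013, Thm. 1.3.2 and Rem. 1.3.5 (ii)–(iii)] -/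
theorem isLocallyUniformizable_perfectField_of_temkin2013_rrLU1Perfect (hT : Temkin2013.{0})
    {p : ℕ} [Fact p.Prime]
    (h1 : ∀ (k K L : Type) [Field k] [CharP k p] [PerfectField k] [Field K] [Field L]
      [Algebra k K] [Algebra K L] [Algebra k L] [IsScalarTower k K L],
      (⊤ : IntermediateField k K).FG → IsPurelyInseparable K L →
      (∃ y : L, y ^ p ∈ (algebraMap K L).range ∧ IntermediateField.adjoin K {y} = ⊤) →
      ∀ B : Subalgebra k L, B.FG → IsFractionRing B L → IsRegularRing B →
      ∀ O : ValuationSubring L, B.toSubring ≤ O.toSubring →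
        IsLocallyUniformizable k K (O.comap (algebraMap K L)))
    (k : Type) [Field k] [CharP k p] [PerfectField k] (K : Type) [Field K] [Algebra k K]
    (hfg : (⊤ : IntermediateField k K).FG) (O : ValuationSubring K)
    (hO : ∀ c : k, algebraMap k K c ∈ O) : IsLocallyUniformizable k K O :=
  isLocallyUniformizable_of_temkin2013_of_rrLU1_at hT k
    (fun K' L' _ _ _ _ _ _ => h1 k K' L') K hfg O hO

/-- **Weak resolution of every reduced separated scheme of finite type over a PERFECT field `k`
of characteristic `p` from `Temkin2013`, RRLU1 over perfect fields and two-model patching of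
proper models over perfect fields** (Zariski–Piltant engine, field by field).
[cite: Piltant2013, Prop. 5.1 and Cor. 5.7] -/
theorem hasResolution_perfectField_of_temkin2013_rrLU1Perfect_twoModelPatchingPerfect
    (hT : Temkin2013.{0}) {p : ℕ} [Fact p.Prime]
    (h1 : ∀ (k K L : Type) [Field k] [CharP k p] [PerfectField k] [Field K] [Field L]
      [Algebra k K] [Algebra K L] [Algebra k L] [IsScalarTower k K L],
      (⊤ : IntermediateField k K).FG → IsPurelyInseparable K L →
      (∃ y : L, y ^ p ∈ (algebraMap K L).range ∧ IntermediateField.adjoin K {y} = ⊤) →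
      ∀ B : Subalgebra k L, B.FG → IsFractionRing B L → IsRegularRing B →
      ∀ O : ValuationSubring L, B.toSubring ≤ O.toSubring →
        IsLocallyUniformizable k K (O.comap (algebraMap K L)))
    (hZ : ∀ (k : Type) [Field k] [CharP k p] [PerfectField k] (K : Type) [Field K] [Algebra k K]
      [Algebra.EssFiniteType k K], ∀ M₁ M₂ : ProperModel k K,
        ∃ (N : ProperModel k K) (φ₁ : N.Hom M₁) (φ₂ : N.Hom M₂), φ₁.RegLe ∧ φ₂.RegLe)
    (k : Type) [Field k] [CharP k p] [PerfectField k] (X : Scheme.{0}) (f : X ⟶ Spec (.of k))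
    [IsSeparated f] [LocallyOfFiniteType f] [QuasiCompact f] [IsReduced X] :
    Scheme.HasResolution X :=
  hasResolution_of_temkin2013_of_rrLU1_at_of_twoModelPatching_at hT k
    (fun K L _ _ _ _ _ _ => h1 k K L) (fun K _ _ _ => hZ k K) X f

/-- **Weak resolution of every reduced separated scheme of finite type over a PERFECT field `k`
of characteristic `p` from `Temkin2013`, RRLU1 over perfect fields and ABSOLUTE-LU PATCHING over
perfect fields** — the patching hypothesis `hP` is, verbatim, the registered stub
`stub_patchingPerfect` at `p` (local uniformization of every finitely generated extension of
every perfect field of characteristic `p` implies weak resolution over every perfect field of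
characteristic `p`); it is fed the local uniformization obtained by the descent.
[cite: Temkin2013, Thm. 1.3.2; Zariski 1940] -/
theorem hasResolution_perfectField_of_temkin2013_rrLU1Perfect_patchingPerfect
    (hT : Temkin2013.{0}) {p : ℕ} [Fact p.Prime]
    (h1 : ∀ (k K L : Type) [Field k] [CharP k p] [PerfectField k] [Field K] [Field L]
      [Algebra k K] [Algebra K L] [Algebra k L] [IsScalarTower k K L],
      (⊤ : IntermediateField k K).FG → IsPurelyInseparable K L →
      (∃ y : L, y ^ p ∈ (algebraMap K L).range ∧ IntermediateField.adjoin K {y} = ⊤) →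
      ∀ B : Subalgebra k L, B.FG → IsFractionRing B L → IsRegularRing B →
      ∀ O : ValuationSubring L, B.toSubring ≤ O.toSubring →
        IsLocallyUniformizable k K (O.comap (algebraMap K L)))
    (hP : (∀ (k K : Type) [Field k] [CharP k p] [PerfectField k] [Field K] [Algebra k K],
        (⊤ : IntermediateField k K).FG → ∀ O : ValuationSubring K,
        (∀ c : k, algebraMap k K c ∈ O) →
        ∃ (A : Subalgebra k K) (h : A.toSubring ≤ O.toSubring), A.FG ∧ IsFractionRing A K ∧
          IsRegularLocalRing (Localization.AtPrime
            (Ideal.comap (Subring.inclusion h) (IsLocalRing.maximalIdeal O)))) →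
      ∀ (k : Type) [Field k] [CharP k p] [PerfectField k] (X : Scheme.{0})
        (f : X ⟶ Spec (.of k)), IsSeparated f → LocallyOfFiniteType f → QuasiCompact f →
        IsReduced X → Scheme.HasResolution X)
    (k : Type) [Field k] [CharP k p] [PerfectField k] (X : Scheme.{0}) (f : X ⟶ Spec (.of k))
    [IsSeparated f] [LocallyOfFiniteType f] [QuasiCompact f] [IsReduced X] :
    Scheme.HasResolution X :=
  hP (fun k' K _ _ _ _ _ hfg O hO =>
      isLocallyUniformizable_perfectField_of_temkin2013_rrLU1Perfect hT h1 k' K hfg O hO)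
    k X f ‹_› ‹_› ‹_› ‹_›

/-! ## The split glue: the crux `Pialt` by name from the perfect-field children -/

/-- **`Pialt` from resolution of every integral separated scheme of finite type over every
PERFECT field of prime characteristic** (a resolution is a purely inseparable regular
alteration; imperfect ground fields by descent from the perfect closure).
[cite: Temkin2013, §1 p. 3 (i), (iii)] -/
theorem pialt_of_forall_perfectField_hasResolution
    (hres : ∀ p : ℕ, p.Prime → ∀ (k : Type) [Field k] [CharP k p] [PerfectField k]
      (X : Scheme.{0}) (f : X ⟶ Spec (.of k)),
      IsSeparated f → LocallyOfFiniteType f → QuasiCompact f → IsIntegral X →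
      Scheme.HasResolution X) :
    Summit.ResolutionOfSingularities.ResolutionOfSingularities.Theses.PAlteration.Pialt :=
  pialt_of_pialt_perfectField fun p hp k _ _ _ =>
    pialtOver_of_forall_hasResolution k (hres p hp k)

/-- **SPLIT GLUE (two-model-patching form).** `Pialt` follows from `Temkin2013`, RRLU1 over
PERFECT fields in every prime characteristic, and two-model patching of proper models over
PERFECT fields in every prime characteristic. The three hypotheses are, verbatim, the registered
stubs `stub_temkin2013`, `stub_rrLU1Perfect`, `stub_twoModelPatchingPerfect` of the v4 skeleton
`Cruxes/Pialt/Lines/SketchIdeator2.lean`. [cite: Temkin2013, Thm. 1.3.2; Piltant2013, Prop. 5.1] -/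
theorem pialt_of_temkin2013_rrLU1Perfect_twoModelPatchingPerfect (hT : Temkin2013.{0})
    (h1 : ∀ p : ℕ, p.Prime → ∀ (k K L : Type) [Field k] [CharP k p] [PerfectField k] [Field K]
      [Field L] [Algebra k K] [Algebra K L] [Algebra k L] [IsScalarTower k K L],
      (⊤ : IntermediateField k K).FG → IsPurelyInseparable K L →
      (∃ y : L, y ^ p ∈ (algebraMap K L).range ∧ IntermediateField.adjoin K {y} = ⊤) →
      ∀ B : Subalgebra k L, B.FG → IsFractionRing B L → IsRegularRing B →
      ∀ O : ValuationSubring L, B.toSubring ≤ O.toSubring →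
        IsLocallyUniformizable k K (O.comap (algebraMap K L)))
    (hZ : ∀ p : ℕ, p.Prime → ∀ (k : Type) [Field k] [CharP k p] [PerfectField k] (K : Type)
      [Field K] [Algebra k K] [Algebra.EssFiniteType k K], ∀ M₁ M₂ : ProperModel k K,
        ∃ (N : ProperModel k K) (φ₁ : N.Hom M₁) (φ₂ : N.Hom M₂), φ₁.RegLe ∧ φ₂.RegLe) :
    Summit.ResolutionOfSingularities.ResolutionOfSingularities.Theses.PAlteration.Pialt := by
  refine pialt_of_forall_perfectField_hasResolution fun p hp k _ _ _ X f hs hl hq hi => ?_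
  haveI : Fact p.Prime := ⟨hp⟩
  haveI := hs; haveI := hl; haveI := hq; haveI := hi
  exact hasResolution_perfectField_of_temkin2013_rrLU1Perfect_twoModelPatchingPerfect hT
    (h1 p hp) (hZ p hp) k X f

/-- **SPLIT GLUE (absolute-LU-patching form).** `Pialt` follows from `Temkin2013`, RRLU1 over
PERFECT fields in every prime characteristic, and absolute-LU patching over PERFECT fields in
every prime characteristic (local uniformization of the finitely generated extensions of the
perfect fields of characteristic `p` implies weak resolution of the reduced separated schemes of
finite type over them). The hypotheses `h1 p hp` / `hP p hp` are, verbatim, the registered stubs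
`stub_rrLU1Perfect p hp` / `stub_patchingPerfect p hp` of crux stmt-0555.
[cite: Temkin2013, Thm. 1.3.2; Piltant2013, Cor. 5.7] -/
theorem pialt_of_temkin2013_rrLU1Perfect_patchingPerfect (hT : Temkin2013.{0})
    (h1 : ∀ p : ℕ, p.Prime → ∀ (k K L : Type) [Field k] [CharP k p] [PerfectField k] [Field K]
      [Field L] [Algebra k K] [Algebra K L] [Algebra k L] [IsScalarTower k K L],
      (⊤ : IntermediateField k K).FG → IsPurelyInseparable K L →
      (∃ y : L, y ^ p ∈ (algebraMap K L).range ∧ IntermediateField.adjoin K {y} = ⊤) →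
      ∀ B : Subalgebra k L, B.FG → IsFractionRing B L → IsRegularRing B →
      ∀ O : ValuationSubring L, B.toSubring ≤ O.toSubring →
        IsLocallyUniformizable k K (O.comap (algebraMap K L)))
    (hP : ∀ p : ℕ, p.Prime →
      (∀ (k K : Type) [Field k] [CharP k p] [PerfectField k] [Field K] [Algebra k K],
        (⊤ : IntermediateField k K).FG → ∀ O : ValuationSubring K,
        (∀ c : k, algebraMap k K c ∈ O) →
        ∃ (A : Subalgebra k K) (h : A.toSubring ≤ O.toSubring), A.FG ∧ IsFractionRing A K ∧
          IsRegularLocalRing (Localization.AtPrime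
            (Ideal.comap (Subring.inclusion h) (IsLocalRing.maximalIdeal O)))) →
      ∀ (k : Type) [Field k] [CharP k p] [PerfectField k] (X : Scheme.{0})
        (f : X ⟶ Spec (.of k)), IsSeparated f → LocallyOfFiniteType f → QuasiCompact f →
        IsReduced X → Scheme.HasResolution X) :
    Summit.ResolutionOfSingularities.ResolutionOfSingularities.Theses.PAlteration.Pialt := by
  refine pialt_of_forall_perfectField_hasResolution fun p hp k _ _ _ X f hs hl hq hi => ?_
  haveI : Fact p.Prime := ⟨hp⟩
  haveI := hs; haveI := hl; haveI := hq; haveI := hi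
  exact hasResolution_perfectField_of_temkin2013_rrLU1Perfect_patchingPerfect hT
    (h1 p hp) (hP p hp) k X f

/-! ## Warrants: no child is stronger than the summit -/

/-- RRLU1 over perfect fields of characteristic `p` follows from local uniformization in
characteristic `p` (it uniformizes `O ∩ K` outright). [folklore] -/
theorem rrLU1Perfect_of_localUniformizationInChar {p : ℕ} (h : LocalUniformizationInChar.{0} p) :
    ∀ (k K L : Type) [Field k] [CharP k p] [PerfectField k] [Field K] [Field L]
      [Algebra k K] [Algebra K L] [Algebra k L] [IsScalarTower k K L],
      (⊤ : IntermediateField k K).FG → IsPurelyInseparable K L →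
      (∃ y : L, y ^ p ∈ (algebraMap K L).range ∧ IntermediateField.adjoin K {y} = ⊤) →
      ∀ B : Subalgebra k L, B.FG → IsFractionRing B L → IsRegularRing B →
      ∀ O : ValuationSubring L, B.toSubring ≤ O.toSubring →
        IsLocallyUniformizable k K (O.comap (algebraMap K L)) :=
  fun k K L _ _ _ _ _ _ _ _ _ hfg hpi hy B hBfg hBfr hBreg O hBO =>
    rrLU1_of_localUniformizationInChar h k K L hfg hpi hy B hBfg hBfr hBreg O hBO

/-- Two-model patching over perfect fields of characteristic `p` is the perfect-field slice of
`ProperModel.TwoModelPatching p`. [cite: Piltant2013, Prop. 5.1 (P = P_reg)] -/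
theorem twoModelPatchingPerfect_of_twoModelPatching {p : ℕ}
    (h : ProperModel.TwoModelPatching.{0} p) :
    ∀ (k : Type) [Field k] [CharP k p] [PerfectField k] (K : Type) [Field K] [Algebra k K]
      [Algebra.EssFiniteType k K], ∀ M₁ M₂ : ProperModel k K,
        ∃ (N : ProperModel k K) (φ₁ : N.Hom M₁) (φ₂ : N.Hom M₂), φ₁.RegLe ∧ φ₂.RegLe :=
  fun k _ _ _ K _ _ _ M₁ M₂ => h k K M₁ M₂

/-- Absolute-LU patching over perfect fields of characteristic `p` (the registered stub
`stub_patchingPerfect` at `p`) follows from two-model patching of proper models over perfect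
fields (the Zariski–Piltant engine `resolutionOverUpToDim_of_properPatching_of_lu`, field by
field, fed the local uniformization over the given perfect field).
[cite: Piltant2013, Prop. 5.1 and Cor. 5.7] -/
theorem patchingPerfect_of_twoModelPatchingPerfect {p : ℕ}
    (hZ : ∀ (k : Type) [Field k] [CharP k p] [PerfectField k] (K : Type) [Field K] [Algebra k K]
      [Algebra.EssFiniteType k K], ∀ M₁ M₂ : ProperModel k K,
        ∃ (N : ProperModel k K) (φ₁ : N.Hom M₁) (φ₂ : N.Hom M₂), φ₁.RegLe ∧ φ₂.RegLe) :
    (∀ (k K : Type) [Field k] [CharP k p] [PerfectField k] [Field K] [Algebra k K],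
        (⊤ : IntermediateField k K).FG → ∀ O : ValuationSubring K,
        (∀ c : k, algebraMap k K c ∈ O) →
        ∃ (A : Subalgebra k K) (h : A.toSubring ≤ O.toSubring), A.FG ∧ IsFractionRing A K ∧
          IsRegularLocalRing (Localization.AtPrime
            (Ideal.comap (Subring.inclusion h) (IsLocalRing.maximalIdeal O)))) →
      ∀ (k : Type) [Field k] [CharP k p] [PerfectField k] (X : Scheme.{0})
        (f : X ⟶ Spec (.of k)), IsSeparated f → LocallyOfFiniteType f → QuasiCompact f →
        IsReduced X → Scheme.HasResolution X := by
  intro hLU k _ _ _ X f hs hl hq hr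
  haveI := hl
  haveI : CompactSpace X := QuasiCompact.compactSpace_of_compactSpace f
  obtain ⟨d, hd⟩ := exists_topologicalKrullDim_le_of_locallyOfFiniteType f
  exact resolutionOverUpToDim_of_properPatching_of_lu (fun K _ _ _ M₁ M₂ => hZ k K M₁ M₂)
    (fun K _ _ hKfg O hO => hLU k K hKfg O hO) d X f hs hl hq hr hd

/-- RRLU1 over perfect fields of characteristic `p` follows from resolution in characteristic
`p`. [folklore] -/
theorem rrLU1Perfect_of_resolutionInChar {p : ℕ} (h : ResolutionInChar.{0} p) :
    ∀ (k K L : Type) [Field k] [CharP k p] [PerfectField k] [Field K] [Field L]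
      [Algebra k K] [Algebra K L] [Algebra k L] [IsScalarTower k K L],
      (⊤ : IntermediateField k K).FG → IsPurelyInseparable K L →
      (∃ y : L, y ^ p ∈ (algebraMap K L).range ∧ IntermediateField.adjoin K {y} = ⊤) →
      ∀ B : Subalgebra k L, B.FG → IsFractionRing B L → IsRegularRing B →
      ∀ O : ValuationSubring L, B.toSubring ≤ O.toSubring →
        IsLocallyUniformizable k K (O.comap (algebraMap K L)) :=
  rrLU1Perfect_of_localUniformizationInChar h.localUniformizationInChar

/-- Two-model patching over perfect fields of characteristic `p` follows from resolution in
characteristic `p` (resolve the join of the two models). [folklore] -/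
theorem twoModelPatchingPerfect_of_resolutionInChar {p : ℕ} (h : ResolutionInChar.{0} p) :
    ∀ (k : Type) [Field k] [CharP k p] [PerfectField k] (K : Type) [Field K] [Algebra k K]
      [Algebra.EssFiniteType k K], ∀ M₁ M₂ : ProperModel k K,
        ∃ (N : ProperModel k K) (φ₁ : N.Hom M₁) (φ₂ : N.Hom M₂), φ₁.RegLe ∧ φ₂.RegLe :=
  twoModelPatchingPerfect_of_twoModelPatching (ProperModel.twoModelPatching_of_resolutionInChar h)

/-- Absolute-LU patching over perfect fields of characteristic `p` follows from resolution in
characteristic `p` (its conclusion does). [folklore] -/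
theorem patchingPerfect_of_resolutionInChar {p : ℕ} (h : ResolutionInChar.{0} p) :
    (∀ (k K : Type) [Field k] [CharP k p] [PerfectField k] [Field K] [Algebra k K],
        (⊤ : IntermediateField k K).FG → ∀ O : ValuationSubring K,
        (∀ c : k, algebraMap k K c ∈ O) →
        ∃ (A : Subalgebra k K) (h : A.toSubring ≤ O.toSubring), A.FG ∧ IsFractionRing A K ∧
          IsRegularLocalRing (Localization.AtPrime
            (Ideal.comap (Subring.inclusion h) (IsLocalRing.maximalIdeal O)))) →
      ∀ (k : Type) [Field k] [CharP k p] [PerfectField k] (X : Scheme.{0})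
        (f : X ⟶ Spec (.of k)), IsSeparated f → LocallyOfFiniteType f → QuasiCompact f →
        IsReduced X → Scheme.HasResolution X :=
  fun _ k _ _ _ X f hs hl hq hr => h k X f hs hl hq hr

/-- Hence the SUMMIT implies all three perfect-field children at every prime (with `Temkin2013`
itself a theorem in print): the split is not stronger than `ResolutionOfSingularities`.
[folklore] -/
theorem splitChildren_of_resolutionOfSingularities (h : _root_.ResolutionOfSingularities) :
    (∀ p : ℕ, p.Prime → ∀ (k K L : Type) [Field k] [CharP k p] [PerfectField k] [Field K]
      [Field L] [Algebra k K] [Algebra K L] [Algebra k L] [IsScalarTower k K L],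
      (⊤ : IntermediateField k K).FG → IsPurelyInseparable K L →
      (∃ y : L, y ^ p ∈ (algebraMap K L).range ∧ IntermediateField.adjoin K {y} = ⊤) →
      ∀ B : Subalgebra k L, B.FG → IsFractionRing B L → IsRegularRing B →
      ∀ O : ValuationSubring L, B.toSubring ≤ O.toSubring →
        IsLocallyUniformizable k K (O.comap (algebraMap K L))) ∧
    (∀ p : ℕ, p.Prime → ∀ (k : Type) [Field k] [CharP k p] [PerfectField k] (K : Type)
      [Field K] [Algebra k K] [Algebra.EssFiniteType k K], ∀ M₁ M₂ : ProperModel k K,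
        ∃ (N : ProperModel k K) (φ₁ : N.Hom M₁) (φ₂ : N.Hom M₂), φ₁.RegLe ∧ φ₂.RegLe) ∧
    (∀ p : ℕ, p.Prime →
      (∀ (k K : Type) [Field k] [CharP k p] [PerfectField k] [Field K] [Algebra k K],
        (⊤ : IntermediateField k K).FG → ∀ O : ValuationSubring K,
        (∀ c : k, algebraMap k K c ∈ O) →
        ∃ (A : Subalgebra k K) (h : A.toSubring ≤ O.toSubring), A.FG ∧ IsFractionRing A K ∧
          IsRegularLocalRing (Localization.AtPrime
            (Ideal.comap (Subring.inclusion h) (IsLocalRing.maximalIdeal O)))) →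
      ∀ (k : Type) [Field k] [CharP k p] [PerfectField k] (X : Scheme.{0})
        (f : X ⟶ Spec (.of k)), IsSeparated f → LocallyOfFiniteType f → QuasiCompact f →
        IsReduced X → Scheme.HasResolution X) :=
  ⟨fun p hp k K L _ _ _ _ _ _ _ _ _ => rrLU1Perfect_of_resolutionInChar (h p hp) k K L,
    fun p hp k _ _ _ K _ _ _ => twoModelPatchingPerfect_of_resolutionInChar (h p hp) k K,
    fun p hp => patchingPerfect_of_resolutionInChar (h p hp)⟩

/-! ## The `FoliationDescent` entry: the RRLU1 child from `FolLU ∧ LogCanQuotLU`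
(bridge `rrLU1_perfect_of_folLU_of_logCanQuotLU`, p137187) -/

/-- **SPLIT GLUE (`FoliationDescent` form).** `Pialt` follows from `Temkin2013`, the two
`FoliationDescent` cruxes `FolLU` and `LogCanQuotLU`, and absolute-LU patching over perfect
fields in every prime characteristic (`stub_patchingPerfect`).
[cite: Temkin2013, Thm. 1.3.2 and Rem. 1.3.5 (ii)–(iii)] -/
theorem pialt_of_temkin2013_folLU_logCanQuotLU_patchingPerfect (hT : Temkin2013.{0})
    (hF : FolLU) (hQ : LogCanQuotLU)
    (hP : ∀ p : ℕ, p.Prime →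
      (∀ (k K : Type) [Field k] [CharP k p] [PerfectField k] [Field K] [Algebra k K],
        (⊤ : IntermediateField k K).FG → ∀ O : ValuationSubring K,
        (∀ c : k, algebraMap k K c ∈ O) →
        ∃ (A : Subalgebra k K) (h : A.toSubring ≤ O.toSubring), A.FG ∧ IsFractionRing A K ∧
          IsRegularLocalRing (Localization.AtPrime
            (Ideal.comap (Subring.inclusion h) (IsLocalRing.maximalIdeal O)))) →
      ∀ (k : Type) [Field k] [CharP k p] [PerfectField k] (X : Scheme.{0})
        (f : X ⟶ Spec (.of k)), IsSeparated f → LocallyOfFiniteType f → QuasiCompact f →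
        IsReduced X → Scheme.HasResolution X) :
    Summit.ResolutionOfSingularities.ResolutionOfSingularities.Theses.PAlteration.Pialt :=
  pialt_of_temkin2013_rrLU1Perfect_patchingPerfect hT
    (fun p hp => rrLU1_perfect_of_folLU_of_logCanQuotLU hF hQ p hp) hP

/-- **SPLIT GLUE (`FoliationDescent` + two-model-patching form).** `Pialt` follows from
`Temkin2013`, `FolLU`, `LogCanQuotLU` and two-model patching of proper models over perfect
fields in every prime characteristic (`stub_twoModelPatchingPerfect`).
[cite: Temkin2013, Thm. 1.3.2; Piltant2013, Prop. 5.1] -/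
theorem pialt_of_temkin2013_folLU_logCanQuotLU_twoModelPatchingPerfect (hT : Temkin2013.{0})
    (hF : FolLU) (hQ : LogCanQuotLU)
    (hZ : ∀ p : ℕ, p.Prime → ∀ (k : Type) [Field k] [CharP k p] [PerfectField k] (K : Type)
      [Field K] [Algebra k K] [Algebra.EssFiniteType k K], ∀ M₁ M₂ : ProperModel k K,
        ∃ (N : ProperModel k K) (φ₁ : N.Hom M₁) (φ₂ : N.Hom M₂), φ₁.RegLe ∧ φ₂.RegLe) :
    Summit.ResolutionOfSingularities.ResolutionOfSingularities.Theses.PAlteration.Pialt :=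
  pialt_of_temkin2013_rrLU1Perfect_twoModelPatchingPerfect hT
    (fun p hp => rrLU1_perfect_of_folLU_of_logCanQuotLU hF hQ p hp) hZ

end Summit.ResolutionOfSingularities.ResolutionOfSingularities.Theorems.Pialt.RadiciallyRegular

end
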